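import Literature.Analysis.FluidPDE.FluidComputer.GalerkinEnergyBalance

/-!
# The energy envelope of an unforced Galerkin solution (Poincaré on the truncation)

A two-sided, row-by-row check that every unforced run of either engine must pass, engine- and
resolution-independent, typed as a theorem of the exact Galerkin system of `GalerkinEnergyBalance`:
if every retained wavevector satisfies `1 ≤ |k|² ≤ K²` (any truncation of `ℤ³ ∖ {0}`; for the cubic
2/3-rule mask `|k_i| ≤ K` one may take `K² = 3K²`), then along any solution of the unforced system with
`ν ≥ 0`, for `s ≤ t`,

  `E_S(s) · e^{-2νK²(t-s)} ≤ E_S(t) ≤ E_S(s) · e^{-2ν(t-s)}`.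

Both follow from the exact energy equation `dE_S/dt = -2νZ_S` (`hasDerivAt_truncEnergy_galerkin`, the
transfer terms cancel) and the two Poincaré-type comparisons `E_S ≤ Z_S ≤ K²E_S` on the truncation
(`truncEnergy_le_truncEnstrophy`, `truncEnstrophy_le_mul_truncEnergy`). The upper envelope with the
lowest shell is [DoeringGibbon1995, §5.3 (5.3.18)–(5.3.20)] specialised to `f = 0` (there with the
forcing term kept); the lower one is the same computation with the largest shell [folklore].

USE (cell pub-fluidc, ATLAS/REFEREE): for consecutive diag rows `(t_i, E_i)` of an unforced run,
`E_i e^{-2νK²Δt} ≤ E_{i+1} ≤ E_i e^{-2νΔt}` up to time-stepping and floating-point error (§C12 of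
LITERATURE.md); a violation beyond that budget is an engine bug, not physics. 0 sorry, 0 named facts.
HONEST FRAMING: typed infrastructure for a low prior, high value-of-information experiment on Tao's
machine paradigm; NOT a claim that NS blows up.
-/

noncomputable section

namespace Literature.Analysis.FluidPDE.FluidComputer

open Finset Set
open scoped BigOperators

namespace ShellTransfer

/-- **Poincaré on the truncation (lower shells)**: if `1 ≤ |k|²` on `S` then `E_S ≤ Z_S`. [cite: DoeringGibbon1995, §5.3 (5.3.19)] -/
theorem truncEnergy_le_truncEnstrophy (U : FourierVelocity) (S : Finset (Fin 3 → ℤ))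
    (h1 : ∀ k ∈ S, 1 ≤ knormSq k) : truncEnergy U S ≤ truncEnstrophy U S := by
  unfold truncEnergy truncEnstrophy
  refine Finset.sum_le_sum fun k hk => ?_
  have := modalEnergy_nonneg U k
  nlinarith [h1 k hk]

/-- **Poincaré on the truncation (upper shell)**: if `|k|² ≤ K²` on `S` then `Z_S ≤ K² E_S`. [folklore] -/
theorem truncEnstrophy_le_mul_truncEnergy (U : FourierVelocity) (S : Finset (Fin 3 → ℤ)) {K2 : ℝ}
    (hK : ∀ k ∈ S, knormSq k ≤ K2) : truncEnstrophy U S ≤ K2 * truncEnergy U S := by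
  unfold truncEnergy truncEnstrophy
  rw [Finset.mul_sum]
  refine Finset.sum_le_sum fun k hk => ?_
  exact mul_le_mul_of_nonneg_right (hK k hk) (modalEnergy_nonneg U k)

/-- `0 ≤ E_S`. [folklore] -/
theorem truncEnergy_nonneg (U : FourierVelocity) (S : Finset (Fin 3 → ℤ)) : 0 ≤ truncEnergy U S :=
  Finset.sum_nonneg fun k _ => modalEnergy_nonneg U k

/-- The unforced energy equation `dE_S/dt = -2νZ_S`. [cite: DoeringGibbon1995, §5.3 (5.3.18)] -/
theorem hasDerivAt_truncEnergy_unforced {U : ℝ → FourierVelocity} {S : Finset (Fin 3 → ℤ)} {ν : ℝ}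
    {c : ℝ → (Fin 3 → ℤ) → ℂ} (hU : IsGalerkinSolution U S ν c fun _ _ _ => 0) (t : ℝ) :
    HasDerivAt (fun s => truncEnergy (U s) S) (-(2 * ν) * truncEnstrophy (U t) S) t := by
  have h := hasDerivAt_truncEnergy_galerkin hU t
  simp only [injectionRate_zero, add_zero] at h
  exact h

/-- The weighted energy `e^{at} E_S(t)` and its derivative. [folklore] -/
theorem hasDerivAt_exp_mul_truncEnergy {U : ℝ → FourierVelocity} {S : Finset (Fin 3 → ℤ)} {ν : ℝ}
    {c : ℝ → (Fin 3 → ℤ) → ℂ} (hU : IsGalerkinSolution U S ν c fun _ _ _ => 0) (a t : ℝ) :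
    HasDerivAt (fun s => Real.exp (a * s) * truncEnergy (U s) S)
      (Real.exp (a * t) * (a * truncEnergy (U t) S - 2 * ν * truncEnstrophy (U t) S)) t := by
  have hexp : HasDerivAt (fun s => Real.exp (a * s)) (Real.exp (a * t) * a) t := by
    have h := ((hasDerivAt_id t).const_mul a).exp
    simp only [id, mul_one] at h
    exact h
  have h := hexp.mul (hasDerivAt_truncEnergy_unforced hU t)
  refine h.congr_deriv ?_
  ring

/-- **UPPER ENVELOPE**: for an unforced Galerkin solution with `ν ≥ 0` on a truncation with `1 ≤ |k|²`,
`E_S(t) ≤ E_S(s) e^{-2ν(t-s)}` for `s ≤ t`. [cite: DoeringGibbon1995, §5.3 (5.3.18)–(5.3.20), f = 0] -/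
theorem truncEnergy_le_mul_exp {U : ℝ → FourierVelocity} {S : Finset (Fin 3 → ℤ)} {ν : ℝ} (hν : 0 ≤ ν)
    (h1 : ∀ k ∈ S, 1 ≤ knormSq k) {c : ℝ → (Fin 3 → ℤ) → ℂ}
    (hU : IsGalerkinSolution U S ν c fun _ _ _ => 0) {s t : ℝ} (hst : s ≤ t) :
    truncEnergy (U t) S ≤ truncEnergy (U s) S * Real.exp (-(2 * ν) * (t - s)) := by
  -- `e^{2νt} E_S(t)` is non-increasing
  have hd := fun x => hasDerivAt_exp_mul_truncEnergy hU (2 * ν) x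
  have hanti : Antitone fun x => Real.exp (2 * ν * x) * truncEnergy (U x) S := by
    refine antitone_of_deriv_nonpos (fun x => (hd x).differentiableAt) fun x => ?_
    rw [(hd x).deriv]
    have hEZ := truncEnergy_le_truncEnstrophy (U x) S h1
    have hpos := Real.exp_pos (2 * ν * x)
    have : 2 * ν * truncEnergy (U x) S - 2 * ν * truncEnstrophy (U x) S ≤ 0 := by nlinarith
    exact mul_nonpos_of_nonneg_of_nonpos hpos.le this
  have h := hanti hst
  -- unweight
  have e : Real.exp (-(2 * ν) * (t - s)) = Real.exp (2 * ν * s) * Real.exp (-(2 * ν * t)) := by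
    rw [← Real.exp_add]; congr 1; ring
  rw [e]
  have ht : Real.exp (-(2 * ν * t)) * (Real.exp (2 * ν * t) * truncEnergy (U t) S) = truncEnergy (U t) S := by
    rw [← mul_assoc, ← Real.exp_add, neg_add_cancel, Real.exp_zero, one_mul]
  calc truncEnergy (U t) S
      = Real.exp (-(2 * ν * t)) * (Real.exp (2 * ν * t) * truncEnergy (U t) S) := ht.symm
    _ ≤ Real.exp (-(2 * ν * t)) * (Real.exp (2 * ν * s) * truncEnergy (U s) S) :=
        mul_le_mul_of_nonneg_left h (Real.exp_pos _).le
    _ = truncEnergy (U s) S * (Real.exp (2 * ν * s) * Real.exp (-(2 * ν * t))) := by ring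

/-- **LOWER ENVELOPE**: for an unforced Galerkin solution with `ν ≥ 0` on a truncation with `|k|² ≤ K²`,
`E_S(s) e^{-2νK²(t-s)} ≤ E_S(t)` for `s ≤ t` — the energy cannot decay faster than the fastest-decaying
retained shell. [folklore] -/
theorem mul_exp_le_truncEnergy {U : ℝ → FourierVelocity} {S : Finset (Fin 3 → ℤ)} {ν : ℝ} (hν : 0 ≤ ν)
    {K2 : ℝ} (hK : ∀ k ∈ S, knormSq k ≤ K2) {c : ℝ → (Fin 3 → ℤ) → ℂ}
    (hU : IsGalerkinSolution U S ν c fun _ _ _ => 0) {s t : ℝ} (hst : s ≤ t) :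
    truncEnergy (U s) S * Real.exp (-(2 * ν * K2) * (t - s)) ≤ truncEnergy (U t) S := by
  -- `e^{2νK²t} E_S(t)` is non-decreasing
  have hd := fun x => hasDerivAt_exp_mul_truncEnergy hU (2 * ν * K2) x
  have hmono : Monotone fun x => Real.exp (2 * ν * K2 * x) * truncEnergy (U x) S := by
    refine monotone_of_deriv_nonneg (fun x => (hd x).differentiableAt) fun x => ?_
    rw [(hd x).deriv]
    have hZE := truncEnstrophy_le_mul_truncEnergy (U x) S hK
    have hpos := Real.exp_pos (2 * ν * K2 * x)
    have : 0 ≤ 2 * ν * K2 * truncEnergy (U x) S - 2 * ν * truncEnstrophy (U x) S := by nlinarith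
    exact mul_nonneg hpos.le this
  have h := hmono hst
  have e : Real.exp (-(2 * ν * K2) * (t - s)) = Real.exp (2 * ν * K2 * s) * Real.exp (-(2 * ν * K2 * t)) := by
    rw [← Real.exp_add]; congr 1; ring
  rw [e]
  have ht : Real.exp (-(2 * ν * K2 * t)) * (Real.exp (2 * ν * K2 * t) * truncEnergy (U t) S) =
      truncEnergy (U t) S := by
    rw [← mul_assoc, ← Real.exp_add, neg_add_cancel, Real.exp_zero, one_mul]
  calc truncEnergy (U s) S * (Real.exp (2 * ν * K2 * s) * Real.exp (-(2 * ν * K2 * t)))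
      = Real.exp (-(2 * ν * K2 * t)) * (Real.exp (2 * ν * K2 * s) * truncEnergy (U s) S) := by ring
    _ ≤ Real.exp (-(2 * ν * K2 * t)) * (Real.exp (2 * ν * K2 * t) * truncEnergy (U t) S) :=
        mul_le_mul_of_nonneg_left h (Real.exp_pos _).le
    _ = truncEnergy (U t) S := ht

/-- **THE ENVELOPE, row form**: `E_S(s)e^{-2νK²(t-s)} ≤ E_S(t) ≤ E_S(s)e^{-2ν(t-s)}` for `s ≤ t`.
[cite: DoeringGibbon1995, §5.3 (5.3.18)–(5.3.20)] -/
theorem truncEnergy_envelope {U : ℝ → FourierVelocity} {S : Finset (Fin 3 → ℤ)} {ν : ℝ} (hν : 0 ≤ ν)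
    {K2 : ℝ} (h1 : ∀ k ∈ S, 1 ≤ knormSq k) (hK : ∀ k ∈ S, knormSq k ≤ K2) {c : ℝ → (Fin 3 → ℤ) → ℂ}
    (hU : IsGalerkinSolution U S ν c fun _ _ _ => 0) {s t : ℝ} (hst : s ≤ t) :
    truncEnergy (U s) S * Real.exp (-(2 * ν * K2) * (t - s)) ≤ truncEnergy (U t) S ∧
      truncEnergy (U t) S ≤ truncEnergy (U s) S * Real.exp (-(2 * ν) * (t - s)) :=
  ⟨mul_exp_le_truncEnergy hν hK hU hst, truncEnergy_le_mul_exp hν h1 hU hst⟩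

/-- The decaying shear wave saturates the upper envelope (`|k|² = 1` on its support): `E_S(t) = e^{-2νt}`.
Non-vacuity of the hypotheses. [folklore] -/
example (ν t : ℝ) : truncEnergy (shearWaveSol ν t) {e3, -e3} = Real.exp (-2 * ν * t) :=
  shearWaveSol_truncEnergy ν t

end ShellTransfer

end Literature.Analysis.FluidPDE.FluidComputer

end
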